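import Summits.AnomalousDissipation.AnomalousDissipation.Theorems.SolenoidalFractalHomogenisationLagrangianStepSidebandXGen
import Summits.AnomalousDissipation.AnomalousDissipation.Theorems.SolenoidalFractalHomogenisationLagrangianStepCellChainClassical
import Mathlib.Analysis.Calculus.Deriv.Prod
import Mathlib.Analysis.Calculus.FDeriv.WithLp
import HarnessLib

/-!
# K1L_D `LagrangianRenormalisationStepDesign` (stmt-AnomalousDissipation-27980), `stub_D1_V0` (V0 = clause (ii) of
# `WCrossing.D1ExactFamily`), brick T4b: THE BOX-TRUNCATED CHAIN OF THE WEAK SOLUTION AS A CLASSICAL ODE IN `Space R` —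
# `Z' = genX·Z + Σⱼ ξⱼ·sourceXⱼ·x + tail`, `x' = −4π²P T x − Σⱼ ξⱼ·P_ℓ feedbackⱼ·Z`
# (helper; `--kind proof --supports stmt-AnomalousDissipation-27980 --as helper`)

Summits-side helper file of route `SolenoidalFractalHomogenisation` (prover seat `ad-k1l-cellLawV-w1` g6).  Everything proved; no definitions, no named
facts, no sorry.  For a weak solution `h : Torus.IsWeakTensorPassiveVectorOn 0 T 𝔹 (W₁.cell n) F u` (integrable datum `F`) and the objects of
`…SidebandXDefs` (`classFreq`, `xiCoeff`, `sbVec`, `genX`, `sourceX`, `tailVec`) and `…SidebandDefs` (`feedback`):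
* `transversalProj_modeRep` — `P_k (modeRep k t) = modeRep k t` on `[0,T]`;
* `neighbour_split` — the neighbour value `modeRep(k_w, t)` of a class point `w` splits EXACTLY into box part `P_{k_w} coordL_w Z`, slow part
  `[w = 0]·x` and outside part `[w ∉ box, w ≠ 0]·modeRep(k_w, t)`;
* **`repRHS_classFreq_eq`** — for every `z ∈ box R` the representative right-hand side of the chain at `k_z` IS
  `(genX Z + Σⱼ ξⱼ • sourceXⱼ x + tailVec)_z` (`Z = sbVec … t`, `x = modeRep ℓ t`; any augmentation `γ₁`);
* **`hasDerivAt_sbVec`** — on `(0,T)`, `HasDerivAt (sbVec … ℓ R) (genX t Z + Σⱼ ξⱼ • sourceXⱼ t x + tailVec t) t`: the box-truncated sideband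
  vector of THE weak solution is a classical solution of the finite-ξ truncated sideband system driven by the slow mode and the truncation tail;
* **`hasDerivAt_slowRep`** — on `(0,T)`, if every `±mⱼ` is retained (`mⱼ ∈ box R`),
  `HasDerivAt (modeRep … ℓ) (−4π² P_ℓ T_{𝔹ᵀ}(ℓ) x − Σⱼ ξⱼ • P_ℓ (feedbackⱼ t Z)) t`: the slow mode is driven by the box vector through the ξ = 0
  feedback functionals of `…SidebandDefs` scaled by `ξⱼ = (êⱼ·ℓ)/n`.
This is the input of brick T4c (the residual `r = Z − P^{(ξ)} Σⱼ ξⱼ Nⱼ x` and its energy inequality) of the V0 architecture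
`Cruxes/LagrangianRenormalisationStep/Lines/onelevel-V0-exact-family.md` §4 as refined by FINDING F-w1g6-1.
NOT a proof of any registered stub, of K1L_D, or of anomalous dissipation; rung F-D1.A0 infrastructure.
-/

set_option linter.dupNamespace false

noncomputable section

namespace Summit.AnomalousDissipation.AnomalousDissipation.Theorems.SolenoidalFractalHomogenisation.LagrangianStep.Sideband

open Set MeasureTheory Complex UnitAddTorus
open scoped InnerProductSpace
open Literature.Analysis Literature.Analysis.FunctionSpaces Literature.Analysis.FunctionSpaces.Torus
open Literature.Analysis.FluidPDE Literature.Analysis.FluidPDE.Torus Literature.Analysis.FluidPDE.LatticeShear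
open Summit.AnomalousDissipation.AnomalousDissipation.Theorems.SolenoidalFractalHomogenisation.LagrangianStep.CellChain
  (linkCoeff modeRep kdot_modeRep hasDerivAt_modeRep)

variable {k₀ : ℕ}

/-! ## §1 Bookkeeping on the class lattice -/

/-- Sums of states evaluate componentwise. [folklore] -/
theorem space_sum_apply {R : ℕ} {ι : Type*} (s : Finset ι) (f : ι → Space R) (z : box R) :
    (∑ j ∈ s, f j) z = ∑ j ∈ s, f j z := by
  classical
  induction s using Finset.induction_on with
  | empty => simp
  | insert a s ha ih => rw [Finset.sum_insert ha, Finset.sum_insert ha, PiLp.add_apply, ih]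

/-- **The representative is transversal at its own mode on `[0,T]`**: `P_k (modeRep k t) = modeRep k t`. [cite: Temam1984, Ch. III §1.1] -/
theorem transversalProj_modeRep (W₁ : LatticeWord k₀) (n : ℕ) {T : ℝ} (hT : 0 ≤ T) {𝔹 : Torus.Visc4 (Fin 3)}
    {F : UnitAddTorus (Fin 3) → EuclideanSpace ℝ (Fin 3)} {u : ℝ → UnitAddTorus (Fin 3) → EuclideanSpace ℝ (Fin 3)}
    (h : Torus.IsWeakTensorPassiveVectorOn 0 T 𝔹 (W₁.cell n) F u) (k : Fin 3 → ℤ) {t : ℝ} (ht : t ∈ Icc 0 T) :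
    transversalProj k (modeRep W₁ n 𝔹 F u k t) = modeRep W₁ n 𝔹 F u k t :=
  transversalProj_eq_self_of_kdot_eq_zero k (kdot_modeRep W₁ n hT h k ht)

/-- **The neighbour split**: for every class point `w`, with `Z = sbVec … t` and `x = modeRep ℓ t`,
`modeRep(k_w, t) = P_{k_w}(coordL_w Z) + [w = 0]·x + [w ∉ box R, w ≠ 0]·modeRep(k_w, t)` (the three cases are exclusive and exhaustive;
the box part is transversal, `coordL` vanishes off the box). [cite: MajdaKramer1999, §2.2.1.3] -/
theorem neighbour_split (W₁ : LatticeWord k₀) (n : ℕ) {T : ℝ} (hT : 0 ≤ T) {𝔹 : Torus.Visc4 (Fin 3)}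
    {F : UnitAddTorus (Fin 3) → EuclideanSpace ℝ (Fin 3)} {u : ℝ → UnitAddTorus (Fin 3) → EuclideanSpace ℝ (Fin 3)}
    (h : Torus.IsWeakTensorPassiveVectorOn 0 T 𝔹 (W₁.cell n) F u) (ℓ : Fin 3 → ℤ) (R : ℕ) {t : ℝ} (ht : t ∈ Icc 0 T) (w : Fin 3 → ℤ) :
    open Classical in
    modeRep W₁ n 𝔹 F u (classFreq n ℓ w) t =
      transversalProj (classFreq n ℓ w) (coordL R w (sbVec W₁ n 𝔹 F u ℓ R t)) +
      (if w = 0 then modeRep W₁ n 𝔹 F u ℓ t else 0) +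
      (if (w ∉ box R ∧ w ≠ 0) then modeRep W₁ n 𝔹 F u (classFreq n ℓ w) t else 0) := by
  classical
  by_cases hw : w ∈ box R
  · have hw0 : w ≠ 0 := ne_zero_of_mem_box hw
    have hno : ¬ (w ∉ box R ∧ w ≠ 0) := fun hc => hc.1 hw
    rw [if_neg hw0, if_neg hno, add_zero, add_zero, coordL_apply_of_mem hw, sbVec_apply, transversalProj_modeRep W₁ n hT h _ ht]
  · rw [coordL_apply_of_not_mem hw, map_zero, zero_add]
    by_cases hw0 : w = 0
    · have hno : ¬ (w ∉ box R ∧ w ≠ 0) := fun hc => hc.2 hw0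
      rw [if_pos hw0, if_neg hno, add_zero, hw0, classFreq_zero]
    · rw [if_neg hw0, if_pos ⟨hw, hw0⟩, zero_add]

/-! ## §2 The box-truncated chain decomposes as `genX·Z + Σ ξⱼ sourceXⱼ·x + tail` -/

/-- Linear bookkeeping of one link after the neighbour split (abstract; atoms are free variables). [folklore] -/
theorem link_split_identity (P : EuclideanSpace ℂ (Fin 3) →L[ℂ] EuclideanSpace ℂ (Fin 3)) (c α β : ℂ)
    (a₁ a₂ a₃ b₁ b₂ b₃ : EuclideanSpace ℂ (Fin 3)) :
    c • P (α • (a₁ + a₂ + a₃) + β • (b₁ + b₂ + b₃))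
      = c • P (α • a₁ + β • b₁) - (-(c • P (α • a₂ + β • b₂))) + c • P (α • a₃ + β • b₃) := by
  simp only [smul_add, map_add, sub_neg_eq_add]
  abel

/-- Linear bookkeeping of the assembled right-hand side (abstract). [folklore] -/
theorem rhs_assemble_identity (V G S Tl : EuclideanSpace ℂ (Fin 3)) :
    -V - (G - S + Tl) = -V - G + S + -Tl := by abel

/-- **THE DECOMPOSITION of the representative right-hand side at a class frequency**: for `z ∈ box R` and `t ∈ [0,T]`,
`−4π² P_{k_z} T_{𝔹ᵀ}(k_z) y_{k_z} − Σⱼ linkCoeffⱼ(k_z,t) • P_{k_z}(αⱼ y_{k_z−Kⱼ} + ᾱⱼ y_{k_z+Kⱼ}) = (genX Z + Σⱼ ξⱼ • sourceXⱼ x + tailVec)_z`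
(`y_κ = modeRep κ t`, `Z = sbVec … t`, `x = y_ℓ`; every augmentation `γ₁`, since `Z` is class-transversal).
[cite: MajdaKramer1999, §2.2.1.3 (cell problem (49))] [cite: MeshalkinSinai1961, pp. 1700–1705] -/
theorem repRHS_classFreq_eq (W₁ : LatticeWord k₀) (n : ℕ) {T : ℝ} (hT : 0 ≤ T) {𝔹 : Torus.Visc4 (Fin 3)}
    {F : UnitAddTorus (Fin 3) → EuclideanSpace ℝ (Fin 3)} {u : ℝ → UnitAddTorus (Fin 3) → EuclideanSpace ℝ (Fin 3)}
    (h : Torus.IsWeakTensorPassiveVectorOn 0 T 𝔹 (W₁.cell n) F u) (ℓ : Fin 3 → ℤ) (γ₁ : ℝ) (R : ℕ) {t : ℝ} (ht : t ∈ Icc 0 T) (z : box R) :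
    (-(((4 * Real.pi ^ 2 : ℝ) : ℂ) • transversalProj (classFreq n ℓ z.1)
        (Torus.symbT (Torus.majorTranspose 𝔹) (classFreq n ℓ z.1) (modeRep W₁ n 𝔹 F u (classFreq n ℓ z.1) t))) -
      ∑ j, linkCoeff W₁ n (classFreq n ℓ z.1) j t • transversalProj (classFreq n ℓ z.1)
        ((Complex.exp ((W₁.phase j).φ * Complex.I) * (1 / (2 * ((2 * Real.pi * ‖latticeVec (W₁.phase j).m‖ : ℝ) : ℂ) * Complex.I))) •
            modeRep W₁ n 𝔹 F u (classFreq n ℓ z.1 - fun i => (W₁.phase j).m i * n) t +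
          (starRingEnd ℂ (Complex.exp ((W₁.phase j).φ * Complex.I)) *
              (-(1 / (2 * ((2 * Real.pi * ‖latticeVec (W₁.phase j).m‖ : ℝ) : ℂ) * Complex.I)))) •
            modeRep W₁ n 𝔹 F u (classFreq n ℓ z.1 + fun i => (W₁.phase j).m i * n) t))
    = genX W₁ n ℓ 𝔹 γ₁ R t (sbVec W₁ n 𝔹 F u ℓ R t) z +
      (∑ j, ((xiCoeff W₁ n ℓ j : ℝ) : ℂ) • sourceX W₁ n ℓ R j t (modeRep W₁ n 𝔹 F u ℓ t)) z +
      tailVec W₁ n 𝔹 F u ℓ R t z := by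
  classical
  -- names
  set Z := sbVec W₁ n 𝔹 F u ℓ R t with hZ
  set x := modeRep W₁ n 𝔹 F u ℓ t with hx
  have hslot : ∀ j, Complex.exp ((W₁.phase j).φ * Complex.I) * (1 / (2 * ((2 * Real.pi * ‖latticeVec (W₁.phase j).m‖ : ℝ) : ℂ) * Complex.I))
      = slotAmp W₁ j := fun j => (slotAmp_def W₁ j).symm
  have hslot' : ∀ j, starRingEnd ℂ (Complex.exp ((W₁.phase j).φ * Complex.I)) *
      (-(1 / (2 * ((2 * Real.pi * ‖latticeVec (W₁.phase j).m‖ : ℝ) : ℂ) * Complex.I))) = starRingEnd ℂ (slotAmp W₁ j) :=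
    fun j => (conj_slotAmp W₁ j).symm
  -- neighbours as class points
  have hsub : ∀ j, (classFreq n ℓ z.1 - fun i => (W₁.phase j).m i * n) = classFreq n ℓ (z.1 - (W₁.phase j).m) :=
    fun j => (classFreq_sub n ℓ z.1 (W₁.phase j).m).symm
  have hadd : ∀ j, (classFreq n ℓ z.1 + fun i => (W₁.phase j).m i * n) = classFreq n ℓ (z.1 + (W₁.phase j).m) :=
    fun j => (classFreq_add n ℓ z.1 (W₁.phase j).m).symm
  simp_rw [hslot, hslot', hsub, hadd]
  obtain ⟨k, hk⟩ : ∃ k : Fin 3 → ℤ, k = classFreq n ℓ z.1 := ⟨_, rfl⟩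
  -- the own mode
  have hownZ : coordL R z.1 Z = modeRep W₁ n 𝔹 F u k t := by
    rw [coordL_apply_of_mem z.2, hZ, sbVec_apply, hk]
  -- genX component
  rw [genX_apply, genXComp_apply, tailVec_apply, ← hk, hownZ, transversalProj_modeRep W₁ n hT h _ ht, sub_self, smul_zero, sub_zero]
  -- source component
  have hsrc : (∑ j, ((xiCoeff W₁ n ℓ j : ℝ) : ℂ) • sourceX W₁ n ℓ R j t x) z =
      ∑ j, ((xiCoeff W₁ n ℓ j : ℝ) : ℂ) • sourceXComp W₁ n ℓ R j t z x := by
    rw [space_sum_apply]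
    refine Finset.sum_congr rfl fun j _ => ?_
    rw [PiLp.smul_apply, sourceX_apply]
  rw [hsrc]
  -- split every neighbour
  have hnb : ∀ j, modeRep W₁ n 𝔹 F u (classFreq n ℓ (z.1 - (W₁.phase j).m)) t =
      transversalProj (classFreq n ℓ (z.1 - (W₁.phase j).m)) (coordL R (z.1 - (W₁.phase j).m) Z) +
      (if z.1 - (W₁.phase j).m = 0 then x else 0) +
      (if (z.1 - (W₁.phase j).m ∉ box R ∧ z.1 - (W₁.phase j).m ≠ 0) then modeRep W₁ n 𝔹 F u (classFreq n ℓ (z.1 - (W₁.phase j).m)) t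
        else 0) := fun j => neighbour_split W₁ n hT h ℓ R ht _
  have hnb' : ∀ j, modeRep W₁ n 𝔹 F u (classFreq n ℓ (z.1 + (W₁.phase j).m)) t =
      transversalProj (classFreq n ℓ (z.1 + (W₁.phase j).m)) (coordL R (z.1 + (W₁.phase j).m) Z) +
      (if z.1 + (W₁.phase j).m = 0 then x else 0) +
      (if (z.1 + (W₁.phase j).m ∉ box R ∧ z.1 + (W₁.phase j).m ≠ 0) then modeRep W₁ n 𝔹 F u (classFreq n ℓ (z.1 + (W₁.phase j).m)) t
        else 0) := fun j => neighbour_split W₁ n hT h ℓ R ht _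
  -- the per-slot identity
  have hj : ∀ j, linkCoeff W₁ n k j t • transversalProj k
        (slotAmp W₁ j • modeRep W₁ n 𝔹 F u (classFreq n ℓ (z.1 - (W₁.phase j).m)) t +
          starRingEnd ℂ (slotAmp W₁ j) • modeRep W₁ n 𝔹 F u (classFreq n ℓ (z.1 + (W₁.phase j).m)) t)
      = linkCoeff W₁ n k j t • transversalProj k
          (slotAmp W₁ j • transversalProj (classFreq n ℓ (z.1 - (W₁.phase j).m)) (coordL R (z.1 - (W₁.phase j).m) Z) +
            starRingEnd ℂ (slotAmp W₁ j) • transversalProj (classFreq n ℓ (z.1 + (W₁.phase j).m)) (coordL R (z.1 + (W₁.phase j).m) Z))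
        - ((xiCoeff W₁ n ℓ j : ℝ) : ℂ) • sourceXComp W₁ n ℓ R j t z x
        + linkCoeff W₁ n k j t • transversalProj k
          (slotAmp W₁ j • (if (z.1 - (W₁.phase j).m ∉ box R ∧ z.1 - (W₁.phase j).m ≠ 0) then
              modeRep W₁ n 𝔹 F u (classFreq n ℓ (z.1 - (W₁.phase j).m)) t else 0) +
            starRingEnd ℂ (slotAmp W₁ j) • (if (z.1 + (W₁.phase j).m ∉ box R ∧ z.1 + (W₁.phase j).m ≠ 0) then
              modeRep W₁ n 𝔹 F u (classFreq n ℓ (z.1 + (W₁.phase j).m)) t else 0)) := by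
    intro j
    -- the slow part is the source
    have hsrcj : ((xiCoeff W₁ n ℓ j : ℝ) : ℂ) • sourceXComp W₁ n ℓ R j t z x =
        -(linkCoeff W₁ n k j t • transversalProj k
          (slotAmp W₁ j • (if z.1 - (W₁.phase j).m = 0 then x else 0) +
            starRingEnd ℂ (slotAmp W₁ j) • (if z.1 + (W₁.phase j).m = 0 then x else 0))) := by
      rw [sourceXComp, add_apply]
      by_cases h1 : z.1 = (W₁.phase j).m
      · have h1' : z.1 - (W₁.phase j).m = 0 := by rw [h1, sub_self]
        have h2 : ¬ z.1 = -(W₁.phase j).m := by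
          intro hc
          have : (W₁.phase j).m = 0 := by
            have e : (W₁.phase j).m = -(W₁.phase j).m := h1.symm.trans hc
            funext i; have := congrFun e i; simp only [Pi.neg_apply] at this; simp only [Pi.zero_apply]; omega
          exact (W₁.phase j).m_ne this
        have h2' : ¬ z.1 + (W₁.phase j).m = 0 := fun hc => h2 (eq_neg_of_add_eq_zero_left hc)
        have hlc : linkCoeff W₁ n k j t = linkCoeff W₁ n ℓ j t := by
          rw [hk, h1]; exact linkCoeff_classFreq_self W₁ n ℓ j t
        rw [if_pos h1', if_neg h2', if_pos h1, if_neg h2, smul_zero, add_zero, zero_apply, add_zero, smul_apply, hlc,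
          linkCoeff_slow_eq, map_smul, smul_smul, smul_smul, ← neg_smul, hk]
        congr 1; ring
      · have h1' : ¬ z.1 - (W₁.phase j).m = 0 := fun hc => h1 (sub_eq_zero.1 hc)
        by_cases h2 : z.1 = -(W₁.phase j).m
        · have h2' : z.1 + (W₁.phase j).m = 0 := by rw [h2, neg_add_cancel]
          have hlc : linkCoeff W₁ n k j t = linkCoeff W₁ n ℓ j t := by
            rw [hk, h2]; exact linkCoeff_classFreq_neg_self W₁ n ℓ j t
          rw [if_neg h1', if_pos h2', if_neg h1, if_pos h2, smul_zero, zero_add, zero_apply, zero_add, smul_apply, hlc,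
            linkCoeff_slow_eq, map_smul, smul_smul, smul_smul, ← neg_smul, hk]
          congr 1; ring
        · have h2' : ¬ z.1 + (W₁.phase j).m = 0 := fun hc => h2 (eq_neg_of_add_eq_zero_left hc)
          rw [if_neg h1', if_neg h2', if_neg h1, if_neg h2]
          simp
    conv_lhs => rw [hnb j, hnb' j]
    rw [hsrcj]
    exact link_split_identity _ _ _ _ _ _ _ _ _ _
  -- assemble
  rw [Finset.sum_congr rfl fun j _ => hj j, Finset.sum_add_distrib, Finset.sum_sub_distrib]
  exact rhs_assemble_identity _ _ _ _

/-! ## §3 The box vector and the slow mode are classical solutions on `(0,T)` -/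

/-- **The box-truncated sideband vector of THE weak solution is a classical solution of the finite-ξ truncated system** on `(0,T)`:
`HasDerivAt Z (genX t Z + Σⱼ ξⱼ • sourceXⱼ t x + tailVec t) t`. [cite: Temam1984, Ch. III §1.1] [cite: MajdaKramer1999, §2.2.1.3] -/
theorem hasDerivAt_sbVec (W₁ : LatticeWord k₀) (n : ℕ) {T : ℝ} {𝔹 : Torus.Visc4 (Fin 3)}
    {F : UnitAddTorus (Fin 3) → EuclideanSpace ℝ (Fin 3)} {u : ℝ → UnitAddTorus (Fin 3) → EuclideanSpace ℝ (Fin 3)}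
    (h : Torus.IsWeakTensorPassiveVectorOn 0 T 𝔹 (W₁.cell n) F u) (hF : Integrable F volume) (ℓ : Fin 3 → ℤ) (γ₁ : ℝ) (R : ℕ)
    {t : ℝ} (ht : t ∈ Ioo 0 T) :
    HasDerivAt (sbVec W₁ n 𝔹 F u ℓ R)
      (genX W₁ n ℓ 𝔹 γ₁ R t (sbVec W₁ n 𝔹 F u ℓ R t) +
        ∑ j, ((xiCoeff W₁ n ℓ j : ℝ) : ℂ) • sourceX W₁ n ℓ R j t (modeRep W₁ n 𝔹 F u ℓ t) +
        tailVec W₁ n 𝔹 F u ℓ R t) t := by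
  have hT : 0 ≤ T := (ht.1.trans ht.2).le
  have ht' : t ∈ Icc 0 T := Ioo_subset_Icc_self ht
  -- componentwise derivative
  have hpi : HasDerivAt (fun s => fun z : box R => modeRep W₁ n 𝔹 F u (classFreq n ℓ z.1) s)
      (fun z : box R =>
        (-(((4 * Real.pi ^ 2 : ℝ) : ℂ) • transversalProj (classFreq n ℓ z.1)
          (Torus.symbT (Torus.majorTranspose 𝔹) (classFreq n ℓ z.1) (modeRep W₁ n 𝔹 F u (classFreq n ℓ z.1) t))) -
        ∑ j, linkCoeff W₁ n (classFreq n ℓ z.1) j t • transversalProj (classFreq n ℓ z.1)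
          ((Complex.exp ((W₁.phase j).φ * Complex.I) * (1 / (2 * ((2 * Real.pi * ‖latticeVec (W₁.phase j).m‖ : ℝ) : ℂ) * Complex.I))) •
              modeRep W₁ n 𝔹 F u (classFreq n ℓ z.1 - fun i => (W₁.phase j).m i * n) t +
            (starRingEnd ℂ (Complex.exp ((W₁.phase j).φ * Complex.I)) *
                (-(1 / (2 * ((2 * Real.pi * ‖latticeVec (W₁.phase j).m‖ : ℝ) : ℂ) * Complex.I)))) •
              modeRep W₁ n 𝔹 F u (classFreq n ℓ z.1 + fun i => (W₁.phase j).m i * n) t))) t :=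
    hasDerivAt_pi.2 fun z => hasDerivAt_modeRep W₁ n h hF (classFreq n ℓ z.1) ht
  have hL := ((PiLp.continuousLinearEquiv 2 ℝ (fun _ : box R => EuclideanSpace ℂ (Fin 3))).symm :
    (box R → EuclideanSpace ℂ (Fin 3)) →L[ℝ] Space R).hasFDerivAt.comp_hasDerivAt t hpi
  have hval : ((PiLp.continuousLinearEquiv 2 ℝ (fun _ : box R => EuclideanSpace ℂ (Fin 3))).symm :
      (box R → EuclideanSpace ℂ (Fin 3)) →L[ℝ] Space R) (fun z : box R =>
        (-(((4 * Real.pi ^ 2 : ℝ) : ℂ) • transversalProj (classFreq n ℓ z.1)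
          (Torus.symbT (Torus.majorTranspose 𝔹) (classFreq n ℓ z.1) (modeRep W₁ n 𝔹 F u (classFreq n ℓ z.1) t))) -
        ∑ j, linkCoeff W₁ n (classFreq n ℓ z.1) j t • transversalProj (classFreq n ℓ z.1)
          ((Complex.exp ((W₁.phase j).φ * Complex.I) * (1 / (2 * ((2 * Real.pi * ‖latticeVec (W₁.phase j).m‖ : ℝ) : ℂ) * Complex.I))) •
              modeRep W₁ n 𝔹 F u (classFreq n ℓ z.1 - fun i => (W₁.phase j).m i * n) t +
            (starRingEnd ℂ (Complex.exp ((W₁.phase j).φ * Complex.I)) *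
                (-(1 / (2 * ((2 * Real.pi * ‖latticeVec (W₁.phase j).m‖ : ℝ) : ℂ) * Complex.I)))) •
              modeRep W₁ n 𝔹 F u (classFreq n ℓ z.1 + fun i => (W₁.phase j).m i * n) t)))
      = genX W₁ n ℓ 𝔹 γ₁ R t (sbVec W₁ n 𝔹 F u ℓ R t) +
        ∑ j, ((xiCoeff W₁ n ℓ j : ℝ) : ℂ) • sourceX W₁ n ℓ R j t (modeRep W₁ n 𝔹 F u ℓ t) +
        tailVec W₁ n 𝔹 F u ℓ R t := by
    apply PiLp.ext
    intro z
    rw [PiLp.add_apply, PiLp.add_apply, ← repRHS_classFreq_eq W₁ n hT h ℓ γ₁ R ht' z]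
    rfl
  rw [hval] at hL
  exact hL

/-- **The slow mode is driven by the box vector through the ξ = 0 feedback functionals**: on `(0,T)`, if every `mⱼ` is retained,
`HasDerivAt (modeRep … ℓ) (−4π² P_ℓ T_{𝔹ᵀ}(ℓ) x − Σⱼ ξⱼ • P_ℓ (feedbackⱼ t Z)) t`. [cite: Temam1984, Ch. III §1.1] [cite: MajdaKramer1999, §2.2.1.3 (55)] -/
theorem hasDerivAt_slowRep (W₁ : LatticeWord k₀) (n : ℕ) {T : ℝ} {𝔹 : Torus.Visc4 (Fin 3)}
    {F : UnitAddTorus (Fin 3) → EuclideanSpace ℝ (Fin 3)} {u : ℝ → UnitAddTorus (Fin 3) → EuclideanSpace ℝ (Fin 3)}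
    (h : Torus.IsWeakTensorPassiveVectorOn 0 T 𝔹 (W₁.cell n) F u) (hF : Integrable F volume) (ℓ : Fin 3 → ℤ) {R : ℕ}
    (hbox : ∀ j, (W₁.phase j).m ∈ box R) {t : ℝ} (ht : t ∈ Ioo 0 T) :
    HasDerivAt (modeRep W₁ n 𝔹 F u ℓ)
      (-(((4 * Real.pi ^ 2 : ℝ) : ℂ) • transversalProj ℓ (Torus.symbT (Torus.majorTranspose 𝔹) ℓ (modeRep W₁ n 𝔹 F u ℓ t))) -
        ∑ j, ((xiCoeff W₁ n ℓ j : ℝ) : ℂ) • transversalProj ℓ (feedback W₁ R j t (sbVec W₁ n 𝔹 F u ℓ R t))) t := by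
  have hd := hasDerivAt_modeRep W₁ n h hF ℓ ht
  refine hd.congr_deriv ?_
  congr 1
  refine Finset.sum_congr rfl fun j _ => ?_
  have hneg : -(W₁.phase j).m ∈ box R := by
    have hm := mem_box.1 (hbox j)
    refine mem_box.2 ⟨fun i => ?_, neg_ne_zero.2 hm.2⟩
    have := hm.1 i
    simp only [Pi.neg_apply]
    omega
  have hsub : (ℓ - fun i => (W₁.phase j).m i * n) = classFreq n ℓ (-(W₁.phase j).m) := by
    have := classFreq_sub n ℓ 0 (W₁.phase j).m
    rw [zero_sub, classFreq_zero] at this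
    exact this.symm
  have hadd : (ℓ + fun i => (W₁.phase j).m i * n) = classFreq n ℓ (W₁.phase j).m := by
    have := classFreq_add n ℓ 0 (W₁.phase j).m
    rw [zero_add, classFreq_zero] at this
    exact this.symm
  rw [hsub, hadd, ← slotAmp_def, ← conj_slotAmp, feedback, smul_apply, add_apply, smul_apply, smul_apply, coordL_apply_of_mem hneg,
    coordL_apply_of_mem (hbox j),
    sbVec_apply, sbVec_apply, linkCoeff_slow_eq, map_smul, smul_smul]

end Summit.AnomalousDissipation.AnomalousDissipation.Theorems.SolenoidalFractalHomogenisation.LagrangianStep.Sideband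

end
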